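import Summits.QuantumAdvantage.QuantumAdvantage.Theorems.CharDialAdaptiveCounterSubcubeA

/-! # CharDialAdaptiveCounterSubcubeB — part 2/3 (mechanical split for landing of `CharDialAdaptiveCounterSubcube`; content verbatim; scopes re-opened with their variables) -/


namespace Summit.QuantumAdvantage.AdviceFreeQNC0
open Finset AffBells22

namespace CounterLaw


/-! ## §5 The `L²` budget w.r.t. the twisted shift `RA t = F⁰ ∘ shK 1 ∘ F¹` -/

section Budget

variable {n : ℕ} (p : ℕ) (v : ℕ → Bool → ZMod p → ZMod 3 → Bool × Bool) (W : Finset (Fin n)) (b : Fin n → Bool)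

/-- the TWISTED SHIFT of step `t`: `RA t = fireA (v t 0) ∘ shK 1 ∘ fireA (v t 1)`. -/
def RA (t : ℕ) : St p ≃ St p := ((fireA p (v t true)).trans (shK p 1)).trans (fireA p (v t false))

/-- the inverse twisted shift, unfolded. -/
theorem RA_symm_apply (t : ℕ) (x : St p) :
    (RA p v t).symm x
      = (bx (bx x.1 (v t false x.2.2 x.2.1)) (v t true (x.2.2 - 1) (x.2.1 - 1)), x.2.1 - 1, x.2.2 - 1) := by
  simp only [RA, Equiv.symm_trans_apply, fireA_symm_apply, shK_symm_apply, Nat.cast_one]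

/-- `E₁⁻¹ ∘ E₀ = (RA t)⁻¹` for the two branch bijections `E_β = bitEq β ∘ fireA (v t β)` of step `t`. -/
theorem branchA_symm_apply (t : ℕ) (x : St p) :
    ((fireA p (v t true)).trans (bitEq p true)).symm (((fireA p (v t false)).trans (bitEq p false)) x)
      = (RA p v t).symm x := by
  rcases x with ⟨g, a, b'⟩
  have e1 : (a + 1 - 2 : ZMod 3) = a - 1 := by ring
  simp [RA_symm_apply, fireA_apply, fireA_symm_apply, bitEq_apply, bitEq_symm_apply, e1]

variable [NeZero p]

/-- `ℓ¹` defect of `μ` under `RA t`. -/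
noncomputable def D1A (t : ℕ) (μ : St p → ℝ) : ℝ := l1 μ (fun x => μ ((RA p v t).symm x))

/-- `ℓ²` defect of `μ` under `RA t`. -/
noncomputable def D2A (t : ℕ) (μ : St p → ℝ) : ℝ := ∑ x, (μ x - μ ((RA p v t).symm x)) ^ 2

/-- CharDialAdaptiveCounterSubcube helper `D1A_nonneg`. -/
theorem D1A_nonneg (t : ℕ) (μ : St p → ℝ) : 0 ≤ D1A p v t μ := l1_nonneg _ _

/-- CharDialAdaptiveCounterSubcube helper `D2A_nonneg`. -/
theorem D2A_nonneg (t : ℕ) (μ : St p → ℝ) : 0 ≤ D2A p v t μ := sum_nonneg fun _ _ => sq_nonneg _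

/-- **parallelogram at an adaptive free step**: the decrement is the defect w.r.t. the twisted shift `RA t`. -/
theorem Q_lawA_succ_free (t : Fin n) (ht : t ∉ W) :
    Q (lawA p v W b (t.val + 1)) = Q (lawA p v W b t.val) - D2A p v t.val (lawA p v W b t.val) / 4 := by
  have h : lawA p v W b (t.val + 1) = fun x =>
      (lawA p v W b t.val (((fireA p (v t.val false)).trans (bitEq p false)).symm x)
        + lawA p v W b t.val (((fireA p (v t.val true)).trans (bitEq p true)).symm x)) / 2 := by
    funext x; rw [lawA_succ_free p v W b t ht x]; rfl
  rw [h, Q_avg, Q_comp_equiv, Q_comp_equiv]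
  have hD : ∑ x, (lawA p v W b t.val (((fireA p (v t.val false)).trans (bitEq p false)).symm x)
      - lawA p v W b t.val (((fireA p (v t.val true)).trans (bitEq p true)).symm x)) ^ 2
      = D2A p v t.val (lawA p v W b t.val) := by
    unfold D2A
    rw [← Equiv.sum_comp ((fireA p (v t.val false)).trans (bitEq p false))
      (fun x => (lawA p v W b t.val (((fireA p (v t.val false)).trans (bitEq p false)).symm x)
        - lawA p v W b t.val (((fireA p (v t.val true)).trans (bitEq p true)).symm x)) ^ 2)]
    refine sum_congr rfl fun x _ => ?_
    simp only [Equiv.symm_apply_apply]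
    rw [branchA_symm_apply]
  rw [hD]; ring

/-- a frozen step preserves `Q`. -/
theorem Q_lawA_succ_frozen (t : Fin n) (ht : t ∈ W) : Q (lawA p v W b (t.val + 1)) = Q (lawA p v W b t.val) := by
  have h : lawA p v W b (t.val + 1) = fun x =>
      lawA p v W b t.val (((fireA p (v t.val (b t))).trans (bitEq p (b t))).symm x) := by
    funext x; rw [lawA_succ_frozen p v W b t ht x]; rfl
  rw [h]; exact Q_comp_equiv _ _

/-- `Q` does not increase along the process. -/
theorem Q_lawA_succ_le (t : Fin n) : Q (lawA p v W b (t.val + 1)) ≤ Q (lawA p v W b t.val) := by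
  by_cases ht : t ∈ W
  · rw [Q_lawA_succ_frozen p v W b t ht]
  · rw [Q_lawA_succ_free p v W b t ht]
    linarith [D2A_nonneg p v t.val (lawA p v W b t.val)]

/-- `Q(lawA 0) = (2ⁿ)²`. -/
theorem Q_lawA_zero : Q (lawA p v W b 0) = ((2 : ℝ) ^ n) ^ 2 := by
  unfold Q
  simp only [lawA_zero]
  rw [Finset.sum_eq_single ((false, false), (0 : ZMod 3), (0 : ZMod p))]
  · simp
  · intro x _ hx; rw [if_neg hx]; ring
  · intro h; exact absurd (mem_univ _) h

/-- Cauchy–Schwarz: `D1A² ≤ 12p·D2A`. -/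
theorem sq_D1A_le (t : ℕ) (μ : St p → ℝ) : D1A p v t μ ^ 2 ≤ 12 * p * D2A p v t μ := by
  have h := sq_l1_le μ (fun x => μ ((RA p v t).symm x))
  rw [card_St] at h
  simpa [D1A, D2A] using h

/-- Cauchy–Schwarz: `(2ⁿ)² ≤ 12p·Q(lawA t)`. -/
theorem sq_le_Q_lawA (t : ℕ) : ((2 : ℝ) ^ n) ^ 2 ≤ 12 * p * Q (lawA p v W b t) := by
  have h := sq_sum_le_card_mul_Q (lawA p v W b t)
  rw [sum_lawA, card_St] at h
  push_cast at h; exact h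

/-- **the budget over the FREE steps**: `Σ_{t ∉ W} D2A t (lawA t) ≤ 4·(2ⁿ)²·(1 − 1/12p)`. -/
theorem sum_D2A_free_le :
    ∑ t ∈ (univ : Finset (Fin n)).filter (fun t => t ∉ W), D2A p v t.val (lawA p v W b t.val)
      ≤ 4 * ((2 : ℝ) ^ n) ^ 2 * (1 - 1 / (12 * p)) := by
  have hfree : ∑ t ∈ (univ : Finset (Fin n)).filter (fun t => t ∉ W), D2A p v t.val (lawA p v W b t.val)
      = ∑ t ∈ (univ : Finset (Fin n)).filter (fun t => t ∉ W),
          4 * (Q (lawA p v W b t.val) - Q (lawA p v W b (t.val + 1))) := by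
    refine sum_congr rfl fun t ht => ?_
    rw [mem_filter] at ht
    rw [Q_lawA_succ_free p v W b t ht.2]; ring
  have hmono : ∑ t ∈ (univ : Finset (Fin n)).filter (fun t => t ∉ W),
        4 * (Q (lawA p v W b t.val) - Q (lawA p v W b (t.val + 1)))
      ≤ ∑ t : Fin n, 4 * (Q (lawA p v W b t.val) - Q (lawA p v W b (t.val + 1))) :=
    sum_le_sum_of_subset_of_nonneg (filter_subset _ _)
      (fun t _ _ => by linarith [Q_lawA_succ_le p v W b t])
  have htel : ∑ t : Fin n, 4 * (Q (lawA p v W b t.val) - Q (lawA p v W b (t.val + 1)))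
      = 4 * (Q (lawA p v W b 0) - Q (lawA p v W b n)) := by
    rw [← mul_sum, Fin.sum_univ_eq_sum_range (fun t => Q (lawA p v W b t) - Q (lawA p v W b (t + 1))) n,
      Finset.sum_range_sub']
  rw [hfree]
  refine hmono.trans ?_
  rw [htel, Q_lawA_zero]
  have hp : (0 : ℝ) < 12 * p := by have := NeZero.pos p; positivity
  have h := sq_le_Q_lawA p v W b n
  have : ((2 : ℝ) ^ n) ^ 2 / (12 * p) ≤ Q (lawA p v W b n) := by rw [div_le_iff₀ hp]; linarith
  have e : 4 * ((2 : ℝ) ^ n) ^ 2 * (1 - 1 / (12 * p)) = 4 * ((2 : ℝ) ^ n) ^ 2 - 4 * (((2 : ℝ) ^ n) ^ 2 / (12 * p)) := by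
    ring
  rw [e]; linarith

/-- **a good FREE time**: if `12p < m + 1`, `m = n − |W|`, some free `t` has `D1A t (lawA t) ≤ 2·2ⁿ·√(12p/(m+1))`. -/
theorem exists_D1A_le_free (hm : 12 * p < (n - W.card) + 1) :
    ∃ t : Fin n, t ∉ W ∧
      D1A p v t.val (lawA p v W b t.val) ≤ 2 * (2 : ℝ) ^ n * Real.sqrt (12 * p / ((n - W.card : ℕ) + 1)) := by
  set F := (univ : Finset (Fin n)).filter (fun t => t ∉ W) with hF
  set m := n - W.card with hmdef
  have hcard : F.card = m := card_free W
  have hm0 : 0 < m := by have := NeZero.pos p; omega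
  have hne : F.Nonempty := by rw [← card_pos, hcard]; exact hm0
  set B : ℝ := 4 * ((2 : ℝ) ^ n) ^ 2 * (1 - 1 / (12 * p)) with hB
  obtain ⟨t, ht, hD2⟩ : ∃ t ∈ F, D2A p v t.val (lawA p v W b t.val) ≤ B / m := by
    apply exists_le_of_sum_le hne
    rw [sum_const, hcard, nsmul_eq_mul]
    have e : (m : ℝ) * (B / m) = B := by field_simp
    rw [e]; exact sum_D2A_free_le p v W b
  refine ⟨t, (mem_filter.mp ht).2, ?_⟩
  have hp : (0 : ℝ) < p := by exact_mod_cast NeZero.pos p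
  have hm' : (0 : ℝ) < m := by exact_mod_cast hm0
  have hm1 : (0 : ℝ) < (m : ℝ) + 1 := by positivity
  set M : ℝ := (2 : ℝ) ^ n with hM
  have hMpos : 0 < M := by positivity
  have h1 : D1A p v t.val (lawA p v W b t.val) ^ 2 ≤ 12 * p * (B / m) :=
    (sq_D1A_le p v _ _).trans (mul_le_mul_of_nonneg_left hD2 (by positivity))
  have h2 : 12 * p * (B / m) ≤ (2 * M) ^ 2 * (12 * p / (m + 1)) := by
    rw [hB]
    have e : 12 * (p : ℝ) * (4 * M ^ 2 * (1 - 1 / (12 * p)) / m) = (2 * M) ^ 2 * ((12 * p - 1) / m) := by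
      field_simp; ring
    rw [e]
    apply mul_le_mul_of_nonneg_left _ (by positivity)
    rw [div_le_div_iff₀ hm' hm1]
    have : (12 * p : ℝ) ≤ m + 1 := by exact_mod_cast hm.le
    nlinarith
  have h3' : D1A p v t.val (lawA p v W b t.val) ^ 2 ≤ (2 * M * Real.sqrt (12 * p / (m + 1))) ^ 2 := by
    rw [mul_pow, Real.sq_sqrt (by positivity)]; exact h1.trans h2
  calc D1A p v t.val (lawA p v W b t.val) = Real.sqrt (D1A p v t.val (lawA p v W b t.val) ^ 2) :=
        (Real.sqrt_sq (D1A_nonneg p v _ _)).symm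
    _ ≤ Real.sqrt ((2 * M * Real.sqrt (12 * p / (m + 1))) ^ 2) := Real.sqrt_le_sqrt h3'
    _ = 2 * M * Real.sqrt (12 * p / (m + 1)) := Real.sqrt_sq (by positivity)

end Budget

end CounterLaw
end Summit.QuantumAdvantage.AdviceFreeQNC0
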